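import Summits.HubbardSuperconductivity.HubbardSuperconductivity.Theorems.KLProgrammeKLRegimeScaleZeroBetaWindowGridSum

/-!
# Route `KLProgramme`, crux K3 — engine-flow child (stmt-HubbardSuperconductivity-20437), stub (C) at `n = 0`, located item #22a «(C)-SCALE0-PT2»:
# THE GENERIC READER CORE — site-summed, weighted, TAIL-AUGMENTED twin of the β-layers D5 / D6 / (β1)

Seat hubbard-kl-k3c5-p1 (g14; owner of #22a).  The profile door of p1 g20 (`…ScaleZeroCovarianceOffSiteContrForm.enorm_contr_gridCov_offSite_le_tsum_profile`)
bounds each off-site covariance factor of the assembly's certified rows `hS0/hS1/hS2` (`…FlowReadScaleZeroAssembly.twoLegRead_frameZero_of_sunsetData`) by an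
image sum PLUS A CONSTANT TAIL, `‖A‖₊ ≤ E_z(u) + T` (`T` = Matsubara-window tail + torus tail, added once per factor).  The product of three such factors,
`(E_z(u) + T)²·(E_{−z}(β − u) + T)`, is not multiplicatively comparable with `E_z²·E_{−z}` (the image sums may vanish), so the octave table that the kit
certifies must enclose the TAIL-AUGMENTED shape.  This file proves that the whole β-chain survives the augmentation, SITE-SUMMED with nonnegative weights
`w_z` (the three rows use `w = 1, ‖z‖₂, ‖z‖₂²`) — pure measure theory in `ℝ≥0∞`, no model objects:

* §1–§2 **D5 twin** `sunsetMajorantT_mul_le` / `sunsetShapeT_mul_le`: `∫_{(0,kβ]} (E^{p}_{kβ}+T)²(E^{q}_{kβ}(kβ−·)+T) ≤ ∫_{(0,β]} (E^{p}_β + kT)²(E^{q}_β(β−·) + kT)`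
  — p1 g19's superadditivity argument (`tsum_profile_eq_sum_tsum`, `prod_three_sum_ge_sum_diag`) with the constant distributed over the `k` residues; the
  tail is multiplied by `k = β′/β ≤ β′/β₀`, which is why the reader's smallness hypothesis reads `(β′/β₀)·T ≤ Tmax`;
* §3 the site-summed version; §4 **D6 twin** (one β-cell, `N` s-cells, table of the `Tmax`-augmented site-summed shape); §5 the octave ⇒ every `β′ ≥ β₀`;
* §6 **(β1) twin**: the time-GRID sum of the raw profiles is below the integral of the `δ`-fattened ones, tails included;
* §7 **`siteSum_sunsetShapeT_gridSum_le_of_octaveTable`** — THE CORE: from (ii′) the octave table of the `Tmax`-augmented, site-summed, weighted shape of the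
  fattened profiles and (iii) its row total `≤ S`, for EVERY `β′ ≥ β₀`, every grid `β′/n ≤ δ` and every tail `T` with `(β′/β₀)·T ≤ Tmax`:
  `Σ_z w_z Σ_{i<n} (β′/n)·(E^{r_z}_{β′}(u_{i+1}) + T)²·(E^{r′_z}_{β′}(β′ − u_{i+1}) + T) ≤ S` (`r_z ≤ P_z`, `r′_z ≤ Q_z` up to `δ`-shifts).
This fixes what the record's clause (ii) must say (V3 of `…SunsetCertDefsV2`: `+ Tmax` inside both periodised factors).

No definitions; nothing here asserts (C), any stub of 20437, K3 or superconductivity.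
References: BGM 2006 §2.3 (2.17)–(2.20) [cite: BenfattoGiulianiMastropietro2006].
-/

noncomputable section

namespace Summit.HubbardSuperconductivity.HubbardSuperconductivity.Theorems.KLRegimeSplit

set_option linter.dupNamespace false -- summit = problem name (single-conjunct summit), D-0017

open MeasureTheory Set Finset
open scoped ENNReal

/-! ## §1 D5 with tails: the superadditivity inequality survives a constant added to each factor -/

/-- **Tail-augmented window inequality** (three factors): for measurable `p₁ p₂ p₃ : ℝ → ℝ≥0∞`, `β > 0`, `k ≥ 1`, `T : ℝ≥0∞`,
`∫_{(0,kβ]} Π_i (E^{pᵢ}_{kβ} + T) ≤ ∫_{(0,β]} Π_i (E^{pᵢ}_β + k·T)`, `E^{p}_γ(τ) = Σ_{m∈ℤ} p(τ + mγ)`. -/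
theorem sunsetMajorantT_mul_le {p₁ p₂ p₃ : ℝ → ℝ≥0∞} (hp₁ : Measurable p₁) (hp₂ : Measurable p₂) (hp₃ : Measurable p₃)
    {β : ℝ} (hβ : 0 < β) (k : ℕ) [NeZero k] (T : ℝ≥0∞) :
    ∫⁻ τ in Ioc 0 ((k : ℝ) * β), ((∑' m : ℤ, p₁ (τ + m * ((k : ℝ) * β))) + T) * ((∑' m : ℤ, p₂ (τ + m * ((k : ℝ) * β))) + T) *
        ((∑' m : ℤ, p₃ (τ + m * ((k : ℝ) * β))) + T) ≤
      ∫⁻ τ in Ioc 0 β, ((∑' m : ℤ, p₁ (τ + m * β)) + k * T) * ((∑' m : ℤ, p₂ (τ + m * β)) + k * T) *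
        ((∑' m : ℤ, p₃ (τ + m * β)) + k * T) := by
  set G : ℝ → ℝ≥0∞ := fun τ => ((∑' m : ℤ, p₁ (τ + m * ((k : ℝ) * β))) + T) * ((∑' m : ℤ, p₂ (τ + m * ((k : ℝ) * β))) + T) *
    ((∑' m : ℤ, p₃ (τ + m * ((k : ℝ) * β))) + T) with hG
  have hGm : Measurable G :=
    (((measurable_tsum_profile hp₁ _).add_const _).mul ((measurable_tsum_profile hp₂ _).add_const _)).mul
      ((measurable_tsum_profile hp₃ _).add_const _)
  have hL : ∫⁻ τ in Ioc 0 ((k : ℝ) * β), G τ = ∫⁻ τ in Ioc 0 β, ∑ j ∈ Finset.range k, G (τ + (j : ℝ) * β) :=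
    (setLIntegral_Ioc_sum_shift_eq G hGm hβ.le k).symm
  change ∫⁻ τ in Ioc 0 ((k : ℝ) * β), G τ ≤ _
  rw [hL]
  refine lintegral_mono fun τ => ?_
  have hk : ∀ a : Fin k → ℝ≥0∞, (∑ j, a j) + k * T = ∑ j, (a j + T) := by
    intro a
    rw [Finset.sum_add_distrib, Finset.sum_const, Finset.card_univ, Fintype.card_fin, nsmul_eq_mul]
  rw [tsum_profile_eq_sum_tsum p₁ β τ k, tsum_profile_eq_sum_tsum p₂ β τ k, tsum_profile_eq_sum_tsum p₃ β τ k,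
    Finset.sum_range, hk, hk, hk]
  refine le_trans (le_of_eq ?_) (prod_three_sum_ge_sum_diag (Finset.univ : Finset (Fin k)) _ _ _)
  refine Finset.sum_congr rfl fun j _ => ?_
  simp only [hG, add_assoc]

/-! ## §2 The sunset shape with tails -/

/-- **Tail-augmented window inequality, sunset shape**: for measurable `p q`, `β > 0`, `k ≥ 1`, `T : ℝ≥0∞`:
`∫_{(0,kβ]} (E^{p}_{kβ}(τ) + T)²·(E^{q}_{kβ}(kβ − τ) + T) dτ ≤ ∫_{(0,β]} (E^{p}_β(τ) + kT)²·(E^{q}_β(β − τ) + kT) dτ`. -/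
theorem sunsetShapeT_mul_le {p q : ℝ → ℝ≥0∞} (hp : Measurable p) (hq : Measurable q) {β : ℝ} (hβ : 0 < β) (k : ℕ) [NeZero k]
    (T : ℝ≥0∞) :
    ∫⁻ τ in Ioc 0 ((k : ℝ) * β), ((∑' m : ℤ, p (τ + m * ((k : ℝ) * β))) + T) ^ 2 *
        ((∑' m : ℤ, q ((k : ℝ) * β - τ + m * ((k : ℝ) * β))) + T) ≤
      ∫⁻ τ in Ioc 0 β, ((∑' m : ℤ, p (τ + m * β)) + k * T) ^ 2 * ((∑' m : ℤ, q (β - τ + m * β)) + k * T) := by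
  have hq' : Measurable fun t : ℝ => q (-t) := hq.comp measurable_neg
  simp_rw [tsum_profile_reflect q, sq]
  exact sunsetMajorantT_mul_le hp hp hq' hβ k T

/-- Measurability of the tail-augmented sunset shape `τ ↦ (E^{p}_β(τ) + T)²·(E^{q}_β(β − τ) + T)`. -/
theorem measurable_sunsetShapeT {p q : ℝ → ℝ≥0∞} (hp : Measurable p) (hq : Measurable q) (β : ℝ) (T : ℝ≥0∞) :
    Measurable fun τ : ℝ => ((∑' m : ℤ, p (τ + m * β)) + T) ^ 2 * ((∑' m : ℤ, q (β - τ + m * β)) + T) := by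
  refine (((measurable_tsum_profile hp β).add_const T).pow_const 2).mul ((Measurable.tsum fun m => ?_).add_const T)
  exact hq.comp ((measurable_const.sub measurable_id).add_const _)

/-! ## §3 Site sums with nonnegative weights -/

/-- **Tail-augmented window inequality, site-summed**: finitely many sites `z ∈ s` with weights `w z : ℝ≥0∞` and measurable profile families `p z, q z`. -/
theorem siteSum_sunsetShapeT_mul_le {ι : Type*} (s : Finset ι) (w : ι → ℝ≥0∞) {p q : ι → ℝ → ℝ≥0∞} (hp : ∀ z, Measurable (p z))
    (hq : ∀ z, Measurable (q z)) {β : ℝ} (hβ : 0 < β) (k : ℕ) [NeZero k] (T : ℝ≥0∞) :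
    ∫⁻ τ in Ioc 0 ((k : ℝ) * β), ∑ z ∈ s, w z * (((∑' m : ℤ, p z (τ + m * ((k : ℝ) * β))) + T) ^ 2 *
        ((∑' m : ℤ, q z ((k : ℝ) * β - τ + m * ((k : ℝ) * β))) + T)) ≤
      ∫⁻ τ in Ioc 0 β, ∑ z ∈ s, w z * (((∑' m : ℤ, p z (τ + m * β)) + k * T) ^ 2 * ((∑' m : ℤ, q z (β - τ + m * β)) + k * T)) := by
  rw [lintegral_finsetSum s (fun z _ => (measurable_sunsetShapeT (hp z) (hq z) _ _).const_mul _),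
    lintegral_finsetSum s (fun z _ => (measurable_sunsetShapeT (hp z) (hq z) _ _).const_mul _)]
  refine Finset.sum_le_sum fun z _ => ?_
  rw [lintegral_const_mul _ (measurable_sunsetShapeT (hp z) (hq z) _ _), lintegral_const_mul _ (measurable_sunsetShapeT (hp z) (hq z) _ _)]
  exact mul_le_mul' le_rfl (sunsetShapeT_mul_le (hp z) (hq z) hβ k T)

/-! ## §4 One β-cell: the table of the `Tmax`-augmented site-summed shape -/

/-- **Cell reader with tails**: `0 < β₁ ≤ β ≤ β₂`, `N ≥ 1` uniform `s`-cells, a table `M_j` enclosing the rescaled, `Tmax`-augmented, site-summed weighted shape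
`Σ_z w_z·(Σ_m p_z(β(s+m)) + Tmax)²·(Σ_m q_z(β(1−s+m)) + Tmax)` on `[β₁, β₂] × (j/N, (j+1)/N]`; then for every tail `T′ ≤ Tmax`:
`∫_{(0,β]} Σ_z w_z·(E^{p_z}_β(τ) + T′)²·(E^{q_z}_β(β−τ) + T′) dτ ≤ β₂·Σ_{j<N} (1/N)·M_j`. -/
theorem siteSum_sunsetShapeT_le_of_cellTable {ι : Type*} (s : Finset ι) (w : ι → ℝ≥0∞) (p q : ι → ℝ → ℝ≥0∞) {β₁ β₂ : ℝ} (hβ₁ : 0 < β₁)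
    (N : ℕ) (hN : 0 < N) (M : ℕ → ℝ≥0∞) {Tmax T' : ℝ≥0∞} (hT : T' ≤ Tmax)
    (hM : ∀ j : ℕ, j < N → ∀ β : ℝ, β₁ ≤ β → β ≤ β₂ → ∀ s' : ℝ, (j : ℝ) / N < s' → s' ≤ ((j : ℝ) + 1) / N →
      ∑ z ∈ s, w z * (((∑' m : ℤ, p z (β * (s' + m))) + Tmax) ^ 2 * ((∑' m : ℤ, q z (β * (1 - s' + m))) + Tmax)) ≤ M j)
    {β : ℝ} (h₁ : β₁ ≤ β) (h₂ : β ≤ β₂) :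
    ∫⁻ τ in Ioc 0 β, ∑ z ∈ s, w z * (((∑' m : ℤ, p z (τ + m * β)) + T') ^ 2 * ((∑' m : ℤ, q z (β - τ + m * β)) + T')) ≤
      ENNReal.ofReal β₂ * ∑ j ∈ Finset.range N, ENNReal.ofReal (1 / N) * M j := by
  have hβ : 0 < β := lt_of_lt_of_le hβ₁ h₁
  rw [setLIntegral_Ioc_eq_mul_unit _ hβ]
  refine mul_le_mul' (ENNReal.ofReal_le_ofReal h₂) ?_
  refine setLIntegral_unit_le_sum_cells _ N hN M fun j hj s' hs1 hs2 => ?_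
  refine le_trans (Finset.sum_le_sum fun z _ => ?_) (hM j hj β h₁ h₂ s' hs1 hs2)
  have hresc1 : (∑' m : ℤ, p z (β * s' + m * β)) = ∑' m : ℤ, p z (β * (s' + m)) := by
    refine tsum_congr fun m => ?_; ring_nf
  have hresc2 : (∑' m : ℤ, q z (β - β * s' + m * β)) = ∑' m : ℤ, q z (β * (1 - s' + m)) := by
    refine tsum_congr fun m => ?_; ring_nf
  rw [hresc1, hresc2]
  exact mul_le_mul' le_rfl (mul_le_mul' (pow_le_pow_left' (add_le_add_right hT _) 2) (add_le_add_right hT _))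

/-! ## §5 The octave table ⇒ every `β′ ≥ β₀`, tails up to `Tmax·β₀/β′` -/

/-- **Octave reader with tails, site-summed**: `K ≥ 1` uniform β-cells of `[β₀, 2β₀]`, `N ≥ 1` `s`-cells, a table `M i j` of the `Tmax`-augmented site-summed
weighted shape with row totals `≤ S`; then for EVERY `β′ ≥ β₀` and every tail `T` with `(β′/β₀)·T ≤ Tmax`:
`∫_{(0,β′]} Σ_z w_z·(E^{p_z}_{β′}(τ) + T)²·(E^{q_z}_{β′}(β′ − τ) + T) dτ ≤ S`. -/
theorem siteSum_sunsetShapeT_le_of_octaveTable {ι : Type*} (s : Finset ι) (w : ι → ℝ≥0∞) {p q : ι → ℝ → ℝ≥0∞}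
    (hp : ∀ z, Measurable (p z)) (hq : ∀ z, Measurable (q z)) {β₀ : ℝ} (hβ₀ : 0 < β₀)
    (K N : ℕ) (hK : 0 < K) (hN : 0 < N) (M : ℕ → ℕ → ℝ≥0∞) {Tmax S : ℝ≥0∞}
    (hM : ∀ i : ℕ, i < K → ∀ j : ℕ, j < N → ∀ β : ℝ, β₀ * (1 + (i : ℝ) / K) ≤ β → β ≤ β₀ * (1 + ((i : ℝ) + 1) / K) →
      ∀ s' : ℝ, (j : ℝ) / N < s' → s' ≤ ((j : ℝ) + 1) / N →
        ∑ z ∈ s, w z * (((∑' m : ℤ, p z (β * (s' + m))) + Tmax) ^ 2 * ((∑' m : ℤ, q z (β * (1 - s' + m))) + Tmax)) ≤ M i j)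
    (hS : ∀ i : ℕ, i < K → ENNReal.ofReal (β₀ * (1 + ((i : ℝ) + 1) / K)) * ∑ j ∈ Finset.range N, ENNReal.ofReal (1 / N) * M i j ≤ S)
    {β' : ℝ} (hβ' : β₀ ≤ β') {T : ℝ≥0∞} (hT : ENNReal.ofReal (β' / β₀) * T ≤ Tmax) :
    ∫⁻ τ in Ioc 0 β', ∑ z ∈ s, w z * (((∑' m : ℤ, p z (τ + m * β')) + T) ^ 2 * ((∑' m : ℤ, q z (β' - τ + m * β')) + T)) ≤ S := by
  obtain ⟨k, hk, hlo, hhi⟩ := exists_nat_mul_mem_window hβ₀ hβ'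
  haveI : NeZero k := ⟨Nat.pos_iff_ne_zero.1 hk⟩
  have hkpos : (0 : ℝ) < k := by exact_mod_cast hk
  have hβ : 0 < β' / k := lt_of_lt_of_le hβ₀ hlo
  have hrw : β' = (k : ℝ) * (β' / k) := by field_simp
  -- the tail picks up the factor `k ≤ β′/β₀`
  have hkT : (k : ℝ≥0∞) * T ≤ Tmax := by
    refine le_trans (mul_le_mul' ?_ le_rfl) hT
    have hkle : (k : ℝ) ≤ β' / β₀ := by
      rw [le_div_iff₀ hβ₀]
      have := (le_div_iff₀ hkpos).1 hlo
      linarith [this]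
    calc (k : ℝ≥0∞) = ENNReal.ofReal (k : ℝ) := (ENNReal.ofReal_natCast k).symm
      _ ≤ ENNReal.ofReal (β' / β₀) := ENNReal.ofReal_le_ofReal hkle
  have key := siteSum_sunsetShapeT_mul_le s w hp hq hβ k T
  rw [← hrw] at key
  refine key.trans ?_
  -- locate `β′/k` in a β-cell of the octave and read the table there
  obtain ⟨i, hi, hc1, hc2⟩ := exists_cell_of_mem_octave hβ₀ K hK hlo hhi
  have hKr : (0 : ℝ) < K := by exact_mod_cast hK
  have hβ₁ : 0 < β₀ * (1 + (i : ℝ) / K) := by positivity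
  exact (siteSum_sunsetShapeT_le_of_cellTable s w p q hβ₁ N hN (M i) hkT
    (fun j hj β hb1 hb2 s' hs1 hs2 => hM i hi j hj β hb1 hb2 s' hs1 hs2) hc1 hc2).trans (hS i hi)

/-! ## §6 (β1) with tails: the time-grid sum of the raw profiles is below the integral of the fattened ones -/

/-- **Grid sunset sum ≤ fattened integral, with tails**: for `β > 0`, `n ≥ 1` grid cells of size `β/n ≤ δ`, profiles `p, q` with `δ`-fattenings `p⁺, q⁺`
and any `T : ℝ≥0∞`: `Σ_{i<n} (β/n)·(E^{p}_β(τ_{i+1}) + T)²·(E^{q}_β(β − τ_{i+1}) + T) ≤ ∫_{(0,β]} (E^{p⁺}_β(τ) + T)²·(E^{q⁺}_β(β − τ) + T) dτ`. -/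
theorem sunsetShapeT_gridSum_le_lintegral {p q pf qf : ℝ → ℝ≥0∞} {δ : ℝ} (hpf : ∀ t u : ℝ, |u - t| ≤ δ → p u ≤ pf t)
    (hqf : ∀ t u : ℝ, |u - t| ≤ δ → q u ≤ qf t) {β : ℝ} (hβ : 0 < β) (n : ℕ) (hn : 0 < n) (hδ : β / n ≤ δ) (T : ℝ≥0∞) :
    ∑ i ∈ Finset.range n, ENNReal.ofReal (β / n) *
        (((∑' m : ℤ, p (((i : ℝ) + 1) * (β / n) + m * β)) + T) ^ 2 * ((∑' m : ℤ, q (β - ((i : ℝ) + 1) * (β / n) + m * β)) + T)) ≤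
      ∫⁻ τ in Ioc 0 β, ((∑' m : ℤ, pf (τ + m * β)) + T) ^ 2 * ((∑' m : ℤ, qf (β - τ + m * β)) + T) := by
  have hnr : (0 : ℝ) < n := by exact_mod_cast hn
  have hε : 0 ≤ β / n := by positivity
  have hnε : (n : ℝ) * (β / n) = β := by field_simp
  have h := gridSum_le_setLIntegral_of_cellMajorant
    (fun i : ℕ => ((∑' m : ℤ, p (((i : ℝ) + 1) * (β / n) + m * β)) + T) ^ 2 * ((∑' m : ℤ, q (β - ((i : ℝ) + 1) * (β / n) + m * β)) + T))
    (fun τ => ((∑' m : ℤ, pf (τ + m * β)) + T) ^ 2 * ((∑' m : ℤ, qf (β - τ + m * β)) + T)) hε n ?_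
  · rwa [hnε] at h
  intro i _ τ h1 h2
  have hdist : |((i : ℝ) + 1) * (β / n) - τ| ≤ δ := by
    rw [abs_le]; constructor <;> nlinarith
  have hdist' : |β - ((i : ℝ) + 1) * (β / n) - (β - τ)| ≤ δ := by
    rw [show β - ((i : ℝ) + 1) * (β / n) - (β - τ) = -(((i : ℝ) + 1) * (β / n) - τ) by ring, abs_neg]; exact hdist
  have hE := tsum_profile_le_of_fattened hpf β hdist
  have hEbar := tsum_profile_le_of_fattened hqf β hdist'
  exact mul_le_mul' (pow_le_pow_left' (add_le_add_left hE _) 2) (add_le_add_left hEbar _)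

/-- **Site-summed grid sum ≤ site-summed fattened integral, with tails.** -/
theorem siteSum_sunsetShapeT_gridSum_le_lintegral {ι : Type*} (s : Finset ι) (w : ι → ℝ≥0∞) {p q pf qf : ι → ℝ → ℝ≥0∞} {δ : ℝ}
    (hpf : ∀ z, ∀ t u : ℝ, |u - t| ≤ δ → p z u ≤ pf z t) (hqf : ∀ z, ∀ t u : ℝ, |u - t| ≤ δ → q z u ≤ qf z t)
    (hpfm : ∀ z, Measurable (pf z)) (hqfm : ∀ z, Measurable (qf z)) {β : ℝ} (hβ : 0 < β) (n : ℕ) (hn : 0 < n) (hδ : β / n ≤ δ)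
    (T : ℝ≥0∞) :
    ∑ z ∈ s, w z * ∑ i ∈ Finset.range n, ENNReal.ofReal (β / n) *
        (((∑' m : ℤ, p z (((i : ℝ) + 1) * (β / n) + m * β)) + T) ^ 2 * ((∑' m : ℤ, q z (β - ((i : ℝ) + 1) * (β / n) + m * β)) + T)) ≤
      ∫⁻ τ in Ioc 0 β, ∑ z ∈ s, w z * (((∑' m : ℤ, pf z (τ + m * β)) + T) ^ 2 * ((∑' m : ℤ, qf z (β - τ + m * β)) + T)) := by
  rw [lintegral_finsetSum s (fun z _ => (measurable_sunsetShapeT (hpfm z) (hqfm z) _ _).const_mul _)]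
  refine Finset.sum_le_sum fun z _ => ?_
  rw [lintegral_const_mul _ (measurable_sunsetShapeT (hpfm z) (hqfm z) _ _)]
  exact mul_le_mul' le_rfl (sunsetShapeT_gridSum_le_lintegral (hpf z) (hqf z) hβ n hn hδ T)

/-! ## §7 THE CORE: one octave table of the tail-augmented fattened shapes bounds every site-summed grid sunset sum -/

/-- **GENERIC READER CORE** (site-summed, weighted, tail-augmented): sites `z ∈ s` with weights `w z : ℝ≥0∞`; raw profiles `p z, q z` dominated up to
`δ`-shifts by measurable fattened profiles `p⁺ z, q⁺ z`; `K ≥ 1` β-cells of the octave `[β₀, 2β₀]`, `N ≥ 1` `s`-cells, a table `M i j` enclosing the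
`Tmax`-AUGMENTED site-summed weighted shape `Σ_z w_z·(Σ_m p⁺_z(β(s+m)) + Tmax)²·(Σ_m q⁺_z(β(1−s+m)) + Tmax)` on every cell (the record's clause (ii′)),
row totals `β₀(1+(i+1)/K)·Σ_j M i j/N ≤ S` (clause (iii)).  Then for EVERY `β′ ≥ β₀`, EVERY grid `n ≥ 1` with `β′/n ≤ δ` and EVERY tail `T` with
`(β′/β₀)·T ≤ Tmax`:  `Σ_z w_z·Σ_{i<n} (β′/n)·(E^{p_z}_{β′}(τ_{i+1}) + T)²·(E^{q_z}_{β′}(β′ − τ_{i+1}) + T) ≤ S`, `τ_{i+1} = (i+1)β′/n`. -/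
theorem siteSum_sunsetShapeT_gridSum_le_of_octaveTable {ι : Type*} (s : Finset ι) (w : ι → ℝ≥0∞) {p q pf qf : ι → ℝ → ℝ≥0∞} {δ : ℝ}
    (hpf : ∀ z, ∀ t u : ℝ, |u - t| ≤ δ → p z u ≤ pf z t) (hqf : ∀ z, ∀ t u : ℝ, |u - t| ≤ δ → q z u ≤ qf z t)
    (hpfm : ∀ z, Measurable (pf z)) (hqfm : ∀ z, Measurable (qf z)) {β₀ : ℝ} (hβ₀ : 0 < β₀)
    (K N : ℕ) (hK : 0 < K) (hN : 0 < N) (M : ℕ → ℕ → ℝ≥0∞) {Tmax S : ℝ≥0∞}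
    (hM : ∀ i : ℕ, i < K → ∀ j : ℕ, j < N → ∀ β : ℝ, β₀ * (1 + (i : ℝ) / K) ≤ β → β ≤ β₀ * (1 + ((i : ℝ) + 1) / K) →
      ∀ s' : ℝ, (j : ℝ) / N < s' → s' ≤ ((j : ℝ) + 1) / N →
        ∑ z ∈ s, w z * (((∑' m : ℤ, pf z (β * (s' + m))) + Tmax) ^ 2 * ((∑' m : ℤ, qf z (β * (1 - s' + m))) + Tmax)) ≤ M i j)
    (hS : ∀ i : ℕ, i < K → ENNReal.ofReal (β₀ * (1 + ((i : ℝ) + 1) / K)) * ∑ j ∈ Finset.range N, ENNReal.ofReal (1 / N) * M i j ≤ S)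
    {β' : ℝ} (hβ' : β₀ ≤ β') (n : ℕ) (hn : 0 < n) (hδ : β' / n ≤ δ) {T : ℝ≥0∞} (hT : ENNReal.ofReal (β' / β₀) * T ≤ Tmax) :
    ∑ z ∈ s, w z * ∑ i ∈ Finset.range n, ENNReal.ofReal (β' / n) *
        (((∑' m : ℤ, p z (((i : ℝ) + 1) * (β' / n) + m * β')) + T) ^ 2 *
          ((∑' m : ℤ, q z (β' - ((i : ℝ) + 1) * (β' / n) + m * β')) + T)) ≤ S :=
  (siteSum_sunsetShapeT_gridSum_le_lintegral s w hpf hqf hpfm hqfm (lt_of_lt_of_le hβ₀ hβ') n hn hδ T).trans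
    (siteSum_sunsetShapeT_le_of_octaveTable s w hpfm hqfm hβ₀ K N hK hN M hM hS hβ' hT)

/-! ## §8 (appended) The same with the fattening hypotheses only ON THE SITE SET (the record certifies profiles on its disk only) -/

/-- **Site-summed grid sum ≤ site-summed fattened integral, with tails** — fattening assumed for `z ∈ s` only. -/
theorem siteSum_sunsetShapeT_gridSum_le_lintegral_of_mem {ι : Type*} (s : Finset ι) (w : ι → ℝ≥0∞) {p q pf qf : ι → ℝ → ℝ≥0∞} {δ : ℝ}
    (hpf : ∀ z ∈ s, ∀ t u : ℝ, |u - t| ≤ δ → p z u ≤ pf z t) (hqf : ∀ z ∈ s, ∀ t u : ℝ, |u - t| ≤ δ → q z u ≤ qf z t)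
    (hpfm : ∀ z, Measurable (pf z)) (hqfm : ∀ z, Measurable (qf z)) {β : ℝ} (hβ : 0 < β) (n : ℕ) (hn : 0 < n) (hδ : β / n ≤ δ)
    (T : ℝ≥0∞) :
    ∑ z ∈ s, w z * ∑ i ∈ Finset.range n, ENNReal.ofReal (β / n) *
        (((∑' m : ℤ, p z (((i : ℝ) + 1) * (β / n) + m * β)) + T) ^ 2 * ((∑' m : ℤ, q z (β - ((i : ℝ) + 1) * (β / n) + m * β)) + T)) ≤
      ∫⁻ τ in Ioc 0 β, ∑ z ∈ s, w z * (((∑' m : ℤ, pf z (τ + m * β)) + T) ^ 2 * ((∑' m : ℤ, qf z (β - τ + m * β)) + T)) := by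
  rw [lintegral_finsetSum s (fun z _ => (measurable_sunsetShapeT (hpfm z) (hqfm z) _ _).const_mul _)]
  refine Finset.sum_le_sum fun z hz => ?_
  rw [lintegral_const_mul _ (measurable_sunsetShapeT (hpfm z) (hqfm z) _ _)]
  exact mul_le_mul' le_rfl (sunsetShapeT_gridSum_le_lintegral (hpf z hz) (hqf z hz) hβ n hn hδ T)

/-- **GENERIC READER CORE, fattening on the site set only** (the form the record reader uses; see `siteSum_sunsetShapeT_gridSum_le_of_octaveTable`). -/
theorem siteSum_sunsetShapeT_gridSum_le_of_octaveTable_of_mem {ι : Type*} (s : Finset ι) (w : ι → ℝ≥0∞) {p q pf qf : ι → ℝ → ℝ≥0∞}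
    {δ : ℝ} (hpf : ∀ z ∈ s, ∀ t u : ℝ, |u - t| ≤ δ → p z u ≤ pf z t) (hqf : ∀ z ∈ s, ∀ t u : ℝ, |u - t| ≤ δ → q z u ≤ qf z t)
    (hpfm : ∀ z, Measurable (pf z)) (hqfm : ∀ z, Measurable (qf z)) {β₀ : ℝ} (hβ₀ : 0 < β₀)
    (K N : ℕ) (hK : 0 < K) (hN : 0 < N) (M : ℕ → ℕ → ℝ≥0∞) {Tmax S : ℝ≥0∞}
    (hM : ∀ i : ℕ, i < K → ∀ j : ℕ, j < N → ∀ β : ℝ, β₀ * (1 + (i : ℝ) / K) ≤ β → β ≤ β₀ * (1 + ((i : ℝ) + 1) / K) →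
      ∀ s' : ℝ, (j : ℝ) / N < s' → s' ≤ ((j : ℝ) + 1) / N →
        ∑ z ∈ s, w z * (((∑' m : ℤ, pf z (β * (s' + m))) + Tmax) ^ 2 * ((∑' m : ℤ, qf z (β * (1 - s' + m))) + Tmax)) ≤ M i j)
    (hS : ∀ i : ℕ, i < K → ENNReal.ofReal (β₀ * (1 + ((i : ℝ) + 1) / K)) * ∑ j ∈ Finset.range N, ENNReal.ofReal (1 / N) * M i j ≤ S)
    {β' : ℝ} (hβ' : β₀ ≤ β') (n : ℕ) (hn : 0 < n) (hδ : β' / n ≤ δ) {T : ℝ≥0∞} (hT : ENNReal.ofReal (β' / β₀) * T ≤ Tmax) :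
    ∑ z ∈ s, w z * ∑ i ∈ Finset.range n, ENNReal.ofReal (β' / n) *
        (((∑' m : ℤ, p z (((i : ℝ) + 1) * (β' / n) + m * β')) + T) ^ 2 *
          ((∑' m : ℤ, q z (β' - ((i : ℝ) + 1) * (β' / n) + m * β')) + T)) ≤ S :=
  (siteSum_sunsetShapeT_gridSum_le_lintegral_of_mem s w hpf hqf hpfm hqfm (lt_of_lt_of_le hβ₀ hβ') n hn hδ T).trans
    (siteSum_sunsetShapeT_le_of_octaveTable s w hpfm hqfm hβ₀ K N hK hN M hM hS hβ' hT)

end Summit.HubbardSuperconductivity.HubbardSuperconductivity.Theorems.KLRegimeSplit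

end
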